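import Summits.CriticalPhenomena.PercolationContinuityZ3.Theorems.PercNearOneGluingNoHeavyConstsHnuWorldReduction
import HarnessLib

/-!
# `MDL(X)′(U) = H-ν(U) + (three-way link correction)` — the exact identity, and `Hν(F∘C_s) ≥ Hν(E[F|C_X]∘C_X)`
# (PAPER-2 track (ii): constants of the CSH family; seat `prim-consts-2`, gen 14)

builds on p205010 (kernel theorem, internal audit signed; external expert review pending).  Support file (`--supports
stmt-CriticalPhenomena-4575`); memo `run/shared/lean/prim/consts/FROM-prim-consts-2-g14-DUAL-HNU.md` §2–§3.  No definitions, no named facts,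
no sorries; standard axioms.  Companion of `…ConstsHnuWorldReduction.lean` (tower identities + the within-world Harris step) and of the
typed conjecture `Consts.AvoidedClusterRepulsion` (`…ConstsDualHnu.lean`).

Notation: owner `s`, avoided set `X`, markers `y, z`; `D = {s ↮ X}`, `T = {y ↮ {s}∪X} ∩ D`, `W = {y ↔ z}`, `Y = {s ↔ y}`, `Z = {s ↔ z}`,
`G_y = {y ↔ X}`, `B' = Z ∪ (W ∩ {y ↮ X})` (observer union), `p' = μ(T∩W)/μ(T)`.  For a test `Φ` the two margins are
`MDLX(Φ) = μ(T)[μ(D)∫_{D∩Z}Φ − (∫_DΦ)μ(D∩Z)] − μ(T∩W)[μ(D)∫_{D∩Y}Φ − (∫_DΦ)μ(D∩Y)]` (the margin of `Consts.MDLXJoint`) and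
`Hν(Φ) = μ(T)[μ(D)∫_{D∩B'}Φ − (∫_DΦ)μ(D∩B')] + μ(T∩W)[μ(D)∫_{D∩G_y}Φ − (∫_DΦ)μ(D∩G_y)]` (the observer-union margin, memo g13 §5).

* `Consts.mdlx_indicator_eq_hnu_add` — **EXACT IDENTITY at every event `U`** (no monotonicity):
  `MDLX(1_U) = Hν(1_U) + μ(D)·[μ(T∩W)μ(U∩T) − μ(T)μ(U∩T∩W)]` (bookkeeping: `μ(D∩U∩B') = μ(D∩U∩Z) + μ(U∩T∩W)`,
  `μ(D∩U) = μ(D∩U∩Y) + μ(D∩U∩G_y) + μ(U∩T)`).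
* `Consts.mdlxJoint_indicator_of_hnu` — hence `Hν(1_U) ≥ 0` and `μ(T)μ(U∩T∩W) ≤ μ(T∩W)μ(U∩T)` (`P(y↔z | T, U) ≤ p'`: the up-event does
  not raise the three-way link probability) give the `Consts.MDLXJoint` inequality at `1_U`.
* `Consts.hnu_ge_hnu_condS` — **`Hν(F∘C_s) ≥ Hν(F̂∘C_X)`** for every monotone `F`, `F̂ = E[F | C_X]` (`BHK2006.condS`): the two tower identities
  and the within-world Harris inequality of the companion file.  `F̂` is antitone in `C_X` (`BHK2006.condS_antitone`), so the conjecture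
  `Consts.AvoidedClusterRepulsion` would make `Hν(F∘C_s) ≥ 0` (file `…ConstsDualHnuConsequences.lean`).
[cite: VandenbergHaggstromKahn2005, §2.1 Lemmas 2.3–2.4 (p. 10), Remark 2.8 (p. 12), pp. 10–13]
-/

noncomputable section

namespace Summit.CriticalPhenomena.PercolationContinuityZ3.Theorems

open MeasureTheory Set Literature.Probability.LatticeModels Literature.Probability.Percolation
open Literature.Probability.Percolation.BHK2006
open scoped Classical

namespace Consts

variable {V : Type*} [Fintype V]

/-- **EXACT IDENTITY — `MDL(X)′(U) = H-ν(U) + μ(D)·[μ(T∩W)μ(U∩T) − μ(T)μ(U∩T∩W)]` for EVERY event `U`** (no monotonicity assumed).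
Here `MDL(X)′(U) = μ(T)[μ(D)μ(D∩U∩Z) − μ(D∩U)μ(D∩Z)] − μ(T∩W)[μ(D)μ(D∩U∩Y) − μ(D∩U)μ(D∩Y)]` is the margin of `Consts.MDLXJoint` at
`F = 1_U`, and `H-ν(U) = μ(T)[μ(D)μ(D∩U∩B') − μ(D∩U)μ(D∩B')] + μ(T∩W)[μ(D)μ(D∩U∩G_y) − μ(D∩U)μ(D∩G_y)]` is the observer-union margin of
memo g13 §5 (`= μ(D)²μ(T)·[Cov_ν(1_U,1_{B'}) + p'·Cov_ν(1_U,1_{G_y})]`).  Bookkeeping only: `μ(D∩U∩B') = μ(D∩U∩Z) + μ(U∩T∩W)` and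
`μ(D∩U) = μ(D∩U∩Y) + μ(D∩U∩G_y) + μ(U∩T)`. [cite: VandenbergHaggstromKahn2005, §2.1 pp. 10–13 (the events); identity derived here] -/
theorem mdlx_indicator_eq_hnu_add (w : Sym2 V → unitInterval) (s y z : V) (X : Set V) (U : Set (BondConfig V)) :
    (prodBernoulli w).real ({ω : BondConfig V | ∀ x ∈ insert s X, ¬ (openGraph ω).Reachable y x} ∩
          {ω | ∀ x ∈ X, ¬ (openGraph ω).Reachable s x}) *
        ((prodBernoulli w).real {ω : BondConfig V | ∀ x ∈ X, ¬ (openGraph ω).Reachable s x} *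
            (prodBernoulli w).real ({ω : BondConfig V | ∀ x ∈ X, ¬ (openGraph ω).Reachable s x} ∩ U ∩ openConn s z) -
          (prodBernoulli w).real ({ω : BondConfig V | ∀ x ∈ X, ¬ (openGraph ω).Reachable s x} ∩ U) *
            (prodBernoulli w).real ({ω : BondConfig V | ∀ x ∈ X, ¬ (openGraph ω).Reachable s x} ∩ openConn s z)) -
      (prodBernoulli w).real ({ω : BondConfig V | ∀ x ∈ insert s X, ¬ (openGraph ω).Reachable y x} ∩
          {ω | ∀ x ∈ X, ¬ (openGraph ω).Reachable s x} ∩ openConn y z) *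
        ((prodBernoulli w).real {ω : BondConfig V | ∀ x ∈ X, ¬ (openGraph ω).Reachable s x} *
            (prodBernoulli w).real ({ω : BondConfig V | ∀ x ∈ X, ¬ (openGraph ω).Reachable s x} ∩ U ∩ openConn s y) -
          (prodBernoulli w).real ({ω : BondConfig V | ∀ x ∈ X, ¬ (openGraph ω).Reachable s x} ∩ U) *
            (prodBernoulli w).real ({ω : BondConfig V | ∀ x ∈ X, ¬ (openGraph ω).Reachable s x} ∩ openConn s y)) =
    ((prodBernoulli w).real ({ω : BondConfig V | ∀ x ∈ insert s X, ¬ (openGraph ω).Reachable y x} ∩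
          {ω | ∀ x ∈ X, ¬ (openGraph ω).Reachable s x}) *
        ((prodBernoulli w).real {ω : BondConfig V | ∀ x ∈ X, ¬ (openGraph ω).Reachable s x} *
            (prodBernoulli w).real ({ω : BondConfig V | ∀ x ∈ X, ¬ (openGraph ω).Reachable s x} ∩ U ∩
              (openConn s z ∪ (openConn y z ∩ {ω | ∀ x ∈ X, ¬ (openGraph ω).Reachable y x}))) -
          (prodBernoulli w).real ({ω : BondConfig V | ∀ x ∈ X, ¬ (openGraph ω).Reachable s x} ∩ U) *
            (prodBernoulli w).real ({ω : BondConfig V | ∀ x ∈ X, ¬ (openGraph ω).Reachable s x} ∩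
              (openConn s z ∪ (openConn y z ∩ {ω | ∀ x ∈ X, ¬ (openGraph ω).Reachable y x})))) +
      (prodBernoulli w).real ({ω : BondConfig V | ∀ x ∈ insert s X, ¬ (openGraph ω).Reachable y x} ∩
          {ω | ∀ x ∈ X, ¬ (openGraph ω).Reachable s x} ∩ openConn y z) *
        ((prodBernoulli w).real {ω : BondConfig V | ∀ x ∈ X, ¬ (openGraph ω).Reachable s x} *
            (prodBernoulli w).real ({ω : BondConfig V | ∀ x ∈ X, ¬ (openGraph ω).Reachable s x} ∩ U ∩
              {ω | ∃ x ∈ X, (openGraph ω).Reachable y x}) -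
          (prodBernoulli w).real ({ω : BondConfig V | ∀ x ∈ X, ¬ (openGraph ω).Reachable s x} ∩ U) *
            (prodBernoulli w).real ({ω : BondConfig V | ∀ x ∈ X, ¬ (openGraph ω).Reachable s x} ∩
              {ω | ∃ x ∈ X, (openGraph ω).Reachable y x}))) +
    (prodBernoulli w).real {ω : BondConfig V | ∀ x ∈ X, ¬ (openGraph ω).Reachable s x} *
      ((prodBernoulli w).real ({ω : BondConfig V | ∀ x ∈ insert s X, ¬ (openGraph ω).Reachable y x} ∩
            {ω | ∀ x ∈ X, ¬ (openGraph ω).Reachable s x} ∩ openConn y z) *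
          (prodBernoulli w).real (U ∩ ({ω : BondConfig V | ∀ x ∈ insert s X, ¬ (openGraph ω).Reachable y x} ∩
            {ω | ∀ x ∈ X, ¬ (openGraph ω).Reachable s x})) -
        (prodBernoulli w).real ({ω : BondConfig V | ∀ x ∈ insert s X, ¬ (openGraph ω).Reachable y x} ∩
            {ω | ∀ x ∈ X, ¬ (openGraph ω).Reachable s x}) *
          (prodBernoulli w).real (U ∩ ({ω : BondConfig V | ∀ x ∈ insert s X, ¬ (openGraph ω).Reachable y x} ∩
            {ω | ∀ x ∈ X, ¬ (openGraph ω).Reachable s x} ∩ openConn y z))) := by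
  classical
  set μ := prodBernoulli w with hμ
  have hmeas : ∀ S : Set (BondConfig V), MeasurableSet S := fun _ => MeasurableSet.of_discrete
  set D : Set (BondConfig V) := {ω | ∀ x ∈ X, ¬ (openGraph ω).Reachable s x} with hD
  set A : Set (BondConfig V) := {ω | ∀ x ∈ insert s X, ¬ (openGraph ω).Reachable y x} with hA
  set Ay : Set (BondConfig V) := {ω | ∀ x ∈ X, ¬ (openGraph ω).Reachable y x} with hAy
  set Gy : Set (BondConfig V) := {ω | ∃ x ∈ X, (openGraph ω).Reachable y x} with hGy
  set Yv : Set (BondConfig V) := openConn s y with hYv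
  set Zv : Set (BondConfig V) := openConn s z with hZv
  set Wv : Set (BondConfig V) := openConn y z with hWv
  set Bp : Set (BondConfig V) := Zv ∪ (Wv ∩ Ay) with hBp
  have mA : ∀ ω, ω ∈ A ↔ ¬ (openGraph ω).Reachable y s ∧ ∀ x ∈ X, ¬ (openGraph ω).Reachable y x := by
    intro ω; simp only [hA, mem_setOf_eq, mem_insert_iff, forall_eq_or_imp]
  have mD : ∀ ω, ω ∈ D ↔ ∀ x ∈ X, ¬ (openGraph ω).Reachable s x := fun ω => Iff.rfl
  have mAy : ∀ ω, ω ∈ Ay ↔ ∀ x ∈ X, ¬ (openGraph ω).Reachable y x := fun ω => Iff.rfl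
  have mGy : ∀ ω, ω ∈ Gy ↔ ∃ x ∈ X, (openGraph ω).Reachable y x := fun ω => Iff.rfl
  have mY : ∀ ω, ω ∈ Yv ↔ (openGraph ω).Reachable s y := fun ω => Iff.rfl
  have mZ : ∀ ω, ω ∈ Zv ↔ (openGraph ω).Reachable s z := fun ω => Iff.rfl
  have mW : ∀ ω, ω ∈ Wv ↔ (openGraph ω).Reachable y z := fun ω => Iff.rfl
  have mBp : ∀ ω, ω ∈ Bp ↔ ω ∈ Zv ∨ (ω ∈ Wv ∧ ω ∈ Ay) := fun ω => by
    simp only [hBp, mem_union, mem_inter_iff]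
  change μ.real (A ∩ D) * (μ.real D * μ.real (D ∩ U ∩ Zv) - μ.real (D ∩ U) * μ.real (D ∩ Zv)) -
      μ.real (A ∩ D ∩ Wv) * (μ.real D * μ.real (D ∩ U ∩ Yv) - μ.real (D ∩ U) * μ.real (D ∩ Yv)) =
    (μ.real (A ∩ D) * (μ.real D * μ.real (D ∩ U ∩ Bp) - μ.real (D ∩ U) * μ.real (D ∩ Bp)) +
      μ.real (A ∩ D ∩ Wv) * (μ.real D * μ.real (D ∩ U ∩ Gy) - μ.real (D ∩ U) * μ.real (D ∩ Gy))) +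
    μ.real D * (μ.real (A ∩ D ∩ Wv) * μ.real (U ∩ (A ∩ D)) - μ.real (A ∩ D) * μ.real (U ∩ (A ∩ D ∩ Wv)))
  -- (a) `μ(R ∩ B') = μ(R ∩ Z) + μ(R ∩ T ∩ W)` for `R = D ∩ U` and `R = D`
  have splitB : ∀ R : Set (BondConfig V), R ⊆ D →
      μ.real (R ∩ Bp) = μ.real (R ∩ Zv) + μ.real (R ∩ (A ∩ D ∩ Wv)) := by
    intro R hR
    have es : R ∩ Bp = R ∩ Zv ∪ R ∩ (A ∩ D ∩ Wv) := by
      ext ω; simp only [mem_inter_iff, mem_union, mBp, mA, mD, mAy, mZ, mW]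
      constructor
      · rintro ⟨hr, hz | ⟨hyz, hay⟩⟩
        · exact Or.inl ⟨hr, hz⟩
        · by_cases hsz : (openGraph ω).Reachable s z
          · exact Or.inl ⟨hr, hsz⟩
          · refine Or.inr ⟨hr, ⟨⟨fun hys => hsz ?_, hay⟩, hR hr⟩, hyz⟩
            exact hys.symm.trans hyz
      · rintro (⟨hr, hz⟩ | ⟨hr, ⟨⟨hys, hay⟩, hd⟩, hyz⟩)
        · exact ⟨hr, Or.inl hz⟩
        · exact ⟨hr, Or.inr ⟨hyz, hay⟩⟩
    have ds : Disjoint (R ∩ Zv) (R ∩ (A ∩ D ∩ Wv)) := by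
      rw [Set.disjoint_left]
      rintro ω ⟨-, hz⟩ ⟨-, ⟨⟨hAω, -⟩, hyz⟩⟩
      rw [mA] at hAω
      exact hAω.1 ((show (openGraph ω).Reachable y z from hyz).trans (show (openGraph ω).Reachable s z from hz).symm)
    rw [es, measureReal_union ds (hmeas _)]
  -- (b) `μ(R) = μ(R ∩ Y) + μ(R ∩ G_y) + μ(R ∩ T)` for `R ⊆ D`
  have splitD : ∀ R : Set (BondConfig V), R ⊆ D →
      μ.real R = μ.real (R ∩ Yv) + μ.real (R ∩ Gy) + μ.real (R ∩ (A ∩ D)) := by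
    intro R hR
    have h1 := measureReal_inter_add_sdiff (μ := μ) (s := R) (hmeas Ay)
    have eG : R \ Ay = R ∩ Gy := by
      ext ω; simp only [mem_sdiff, mem_inter_iff, mAy, mGy, not_forall, not_not, exists_prop]
    rw [eG] at h1
    have h2 := measureReal_inter_add_sdiff (μ := μ) (s := R ∩ Ay) (hmeas Yv)
    have eY : R ∩ Ay ∩ Yv = R ∩ Yv := by
      ext ω; simp only [mem_inter_iff, mAy, mY]
      constructor
      · rintro ⟨⟨hr, -⟩, hy⟩; exact ⟨hr, hy⟩
      · rintro ⟨hr, hy⟩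
        exact ⟨⟨hr, fun x hx hyx => (hR hr) x hx (hy.trans hyx)⟩, hy⟩
    have eN : (R ∩ Ay) \ Yv = R ∩ (A ∩ D) := by
      ext ω; simp only [mem_sdiff, mem_inter_iff, mAy, mY, mA, mD]
      constructor
      · rintro ⟨⟨hr, hay⟩, hny⟩
        exact ⟨hr, ⟨fun hys => hny hys.symm, hay⟩, hR hr⟩
      · rintro ⟨hr, ⟨hys, hay⟩, hd⟩
        exact ⟨⟨hr, hay⟩, fun hsy => hys hsy.symm⟩
    rw [eY, eN] at h2
    linarith
  have hDU : D ∩ U ⊆ D := inter_subset_left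
  have b1 := splitB (D ∩ U) hDU
  have b2 := splitB D Subset.rfl
  have c1 := splitD (D ∩ U) hDU
  have c2 := splitD D Subset.rfl
  -- normalise the intersections appearing in `splitB` / `splitD`
  have n1 : D ∩ U ∩ (A ∩ D ∩ Wv) = U ∩ (A ∩ D ∩ Wv) := by
    ext ω; simp only [mem_inter_iff]; tauto
  have n2 : D ∩ (A ∩ D ∩ Wv) = A ∩ D ∩ Wv := by
    ext ω; simp only [mem_inter_iff]; tauto
  have n3 : D ∩ U ∩ (A ∩ D) = U ∩ (A ∩ D) := by
    ext ω; simp only [mem_inter_iff]; tauto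
  have n4 : D ∩ (A ∩ D) = A ∩ D := by
    ext ω; simp only [mem_inter_iff]; tauto
  rw [n1] at b1
  rw [n2] at b2
  rw [n3] at c1
  rw [n4] at c2
  rw [b1, b2]
  linear_combination (μ.real (A ∩ D ∩ Wv) * μ.real D) * c1 - (μ.real (A ∩ D ∩ Wv) * μ.real (D ∩ U)) * c2

/-- **`Consts.MDLXJoint` at `1_U` from H-ν(U) and the sign condition "`U` does not raise the three-way link probability".**  If
`μ(T)[μ(D)μ(D∩U∩B') − μ(D∩U)μ(D∩B')] + μ(T∩W)[μ(D)μ(D∩U∩G_y) − μ(D∩U)μ(D∩G_y)] ≥ 0` (H-ν at `U`) and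
`μ(T)·μ(U∩T∩W) ≤ μ(T∩W)·μ(U∩T)` (`P(y↔z | T, U) ≤ P(y↔z | T) = p'`), then
`μ(T∩W)[μ(D)μ(D∩U∩Y) − μ(D∩U)μ(D∩Y)] ≤ μ(T)[μ(D)μ(D∩U∩Z) − μ(D∩U)μ(D∩Z)]` — by `Consts.mdlx_indicator_eq_hnu_add`.
[cite: VandenbergHaggstromKahn2005, §2.1 pp. 10–13 — bookkeeping, derived here] -/
theorem mdlxJoint_indicator_of_hnu (w : Sym2 V → unitInterval) (s y z : V) (X : Set V) (U : Set (BondConfig V))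
    (hnu : 0 ≤ (prodBernoulli w).real ({ω : BondConfig V | ∀ x ∈ insert s X, ¬ (openGraph ω).Reachable y x} ∩
          {ω | ∀ x ∈ X, ¬ (openGraph ω).Reachable s x}) *
        ((prodBernoulli w).real {ω : BondConfig V | ∀ x ∈ X, ¬ (openGraph ω).Reachable s x} *
            (prodBernoulli w).real ({ω : BondConfig V | ∀ x ∈ X, ¬ (openGraph ω).Reachable s x} ∩ U ∩
              (openConn s z ∪ (openConn y z ∩ {ω | ∀ x ∈ X, ¬ (openGraph ω).Reachable y x}))) -
          (prodBernoulli w).real ({ω : BondConfig V | ∀ x ∈ X, ¬ (openGraph ω).Reachable s x} ∩ U) *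
            (prodBernoulli w).real ({ω : BondConfig V | ∀ x ∈ X, ¬ (openGraph ω).Reachable s x} ∩
              (openConn s z ∪ (openConn y z ∩ {ω | ∀ x ∈ X, ¬ (openGraph ω).Reachable y x})))) +
      (prodBernoulli w).real ({ω : BondConfig V | ∀ x ∈ insert s X, ¬ (openGraph ω).Reachable y x} ∩
          {ω | ∀ x ∈ X, ¬ (openGraph ω).Reachable s x} ∩ openConn y z) *
        ((prodBernoulli w).real {ω : BondConfig V | ∀ x ∈ X, ¬ (openGraph ω).Reachable s x} *
            (prodBernoulli w).real ({ω : BondConfig V | ∀ x ∈ X, ¬ (openGraph ω).Reachable s x} ∩ U ∩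
              {ω | ∃ x ∈ X, (openGraph ω).Reachable y x}) -
          (prodBernoulli w).real ({ω : BondConfig V | ∀ x ∈ X, ¬ (openGraph ω).Reachable s x} ∩ U) *
            (prodBernoulli w).real ({ω : BondConfig V | ∀ x ∈ X, ¬ (openGraph ω).Reachable s x} ∩
              {ω | ∃ x ∈ X, (openGraph ω).Reachable y x})))
    (hlink : (prodBernoulli w).real ({ω : BondConfig V | ∀ x ∈ insert s X, ¬ (openGraph ω).Reachable y x} ∩
            {ω | ∀ x ∈ X, ¬ (openGraph ω).Reachable s x}) *
          (prodBernoulli w).real (U ∩ ({ω : BondConfig V | ∀ x ∈ insert s X, ¬ (openGraph ω).Reachable y x} ∩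
            {ω | ∀ x ∈ X, ¬ (openGraph ω).Reachable s x} ∩ openConn y z)) ≤
        (prodBernoulli w).real ({ω : BondConfig V | ∀ x ∈ insert s X, ¬ (openGraph ω).Reachable y x} ∩
            {ω | ∀ x ∈ X, ¬ (openGraph ω).Reachable s x} ∩ openConn y z) *
          (prodBernoulli w).real (U ∩ ({ω : BondConfig V | ∀ x ∈ insert s X, ¬ (openGraph ω).Reachable y x} ∩
            {ω | ∀ x ∈ X, ¬ (openGraph ω).Reachable s x}))) :
    (prodBernoulli w).real ({ω : BondConfig V | ∀ x ∈ insert s X, ¬ (openGraph ω).Reachable y x} ∩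
          {ω | ∀ x ∈ X, ¬ (openGraph ω).Reachable s x} ∩ openConn y z) *
        ((prodBernoulli w).real {ω : BondConfig V | ∀ x ∈ X, ¬ (openGraph ω).Reachable s x} *
            (prodBernoulli w).real ({ω : BondConfig V | ∀ x ∈ X, ¬ (openGraph ω).Reachable s x} ∩ U ∩ openConn s y) -
          (prodBernoulli w).real ({ω : BondConfig V | ∀ x ∈ X, ¬ (openGraph ω).Reachable s x} ∩ U) *
            (prodBernoulli w).real ({ω : BondConfig V | ∀ x ∈ X, ¬ (openGraph ω).Reachable s x} ∩ openConn s y)) ≤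
      (prodBernoulli w).real ({ω : BondConfig V | ∀ x ∈ insert s X, ¬ (openGraph ω).Reachable y x} ∩
          {ω | ∀ x ∈ X, ¬ (openGraph ω).Reachable s x}) *
        ((prodBernoulli w).real {ω : BondConfig V | ∀ x ∈ X, ¬ (openGraph ω).Reachable s x} *
            (prodBernoulli w).real ({ω : BondConfig V | ∀ x ∈ X, ¬ (openGraph ω).Reachable s x} ∩ U ∩ openConn s z) -
          (prodBernoulli w).real ({ω : BondConfig V | ∀ x ∈ X, ¬ (openGraph ω).Reachable s x} ∩ U) *
            (prodBernoulli w).real ({ω : BondConfig V | ∀ x ∈ X, ¬ (openGraph ω).Reachable s x} ∩ openConn s z)) := by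
  have hid := mdlx_indicator_eq_hnu_add w s y z X U
  have h0 : 0 ≤ (prodBernoulli w).real {ω : BondConfig V | ∀ x ∈ X, ¬ (openGraph ω).Reachable s x} := measureReal_nonneg
  nlinarith [hid, hnu, hlink, mul_nonneg h0 (sub_nonneg.2 hlink)]

/-- **`Hν(F ∘ C_s) ≥ Hν(F̂ ∘ C_X)` for every monotone functional `F` of `C_s`** (`F̂ = E[F | C_X]`, BHK's half-step `condS`):
the observer-union margin `Hν(Φ) = μ(T)·[μ(D)∫_{D∩B'} Φ − (∫_D Φ) μ(D∩B')] + μ(T∩W)·[μ(D)∫_{D∩G_y} Φ − (∫_D Φ) μ(D∩G_y)]`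
(`T = {y ↮ {s}∪X} ∩ D`) does not increase when `F(C_s)` is replaced by its conditional expectation given the avoided cluster — the law
of total covariance along `σ(C_X)` with the within-world part `≥ 0` by Harris (`Consts.setIntegral_avoid_observer_ge_condS`) and the two
tower identities.  Since `F̂` is an ANTITONE functional of `C_X` (`BHK2006.condS_antitone`), the conjectured dual inequality for the avoided
cluster (`Consts.AvoidedClusterRepulsion`, gen 14) would make the right-hand side, hence `Hν(F ∘ C_s)`, nonnegative.
[cite: VandenbergHaggstromKahn2005, §2.1 Lemmas 2.3–2.4 (p. 10), Remark 2.8 (p. 12); §1 p. 4 display (4)] -/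
theorem hnu_ge_hnu_condS (w : Sym2 V → unitInterval) (s y z : V) (X : Set V) {F : Set (Sym2 V) → ℝ} (hF : Monotone F) :
    (prodBernoulli w).real ({ω : BondConfig V | ∀ x ∈ insert s X, ¬ (openGraph ω).Reachable y x} ∩
          {ω | ∀ x ∈ X, ¬ (openGraph ω).Reachable s x}) *
        ((prodBernoulli w).real {ω : BondConfig V | ∀ x ∈ X, ¬ (openGraph ω).Reachable s x} *
            (∫ ω in {ω : BondConfig V | ∀ x ∈ X, ¬ (openGraph ω).Reachable s x} ∩
                (openConn s z ∪ (openConn y z ∩ {ω | ∀ x ∈ X, ¬ (openGraph ω).Reachable y x})),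
              condS (fun e => (w e : ℝ)) {s} X F (⋃ x ∈ X, openEdgeCluster ω x) ∂(prodBernoulli w)) -
          (∫ ω in {ω : BondConfig V | ∀ x ∈ X, ¬ (openGraph ω).Reachable s x},
              condS (fun e => (w e : ℝ)) {s} X F (⋃ x ∈ X, openEdgeCluster ω x) ∂(prodBernoulli w)) *
            (prodBernoulli w).real ({ω : BondConfig V | ∀ x ∈ X, ¬ (openGraph ω).Reachable s x} ∩
              (openConn s z ∪ (openConn y z ∩ {ω | ∀ x ∈ X, ¬ (openGraph ω).Reachable y x})))) +
      (prodBernoulli w).real ({ω : BondConfig V | ∀ x ∈ insert s X, ¬ (openGraph ω).Reachable y x} ∩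
          {ω | ∀ x ∈ X, ¬ (openGraph ω).Reachable s x} ∩ openConn y z) *
        ((prodBernoulli w).real {ω : BondConfig V | ∀ x ∈ X, ¬ (openGraph ω).Reachable s x} *
            (∫ ω in {ω : BondConfig V | ∀ x ∈ X, ¬ (openGraph ω).Reachable s x} ∩
                {ω | ∃ x ∈ X, (openGraph ω).Reachable y x},
              condS (fun e => (w e : ℝ)) {s} X F (⋃ x ∈ X, openEdgeCluster ω x) ∂(prodBernoulli w)) -
          (∫ ω in {ω : BondConfig V | ∀ x ∈ X, ¬ (openGraph ω).Reachable s x},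
              condS (fun e => (w e : ℝ)) {s} X F (⋃ x ∈ X, openEdgeCluster ω x) ∂(prodBernoulli w)) *
            (prodBernoulli w).real ({ω : BondConfig V | ∀ x ∈ X, ¬ (openGraph ω).Reachable s x} ∩
              {ω | ∃ x ∈ X, (openGraph ω).Reachable y x})) ≤
    (prodBernoulli w).real ({ω : BondConfig V | ∀ x ∈ insert s X, ¬ (openGraph ω).Reachable y x} ∩
          {ω | ∀ x ∈ X, ¬ (openGraph ω).Reachable s x}) *
        ((prodBernoulli w).real {ω : BondConfig V | ∀ x ∈ X, ¬ (openGraph ω).Reachable s x} *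
            (∫ ω in {ω : BondConfig V | ∀ x ∈ X, ¬ (openGraph ω).Reachable s x} ∩
                (openConn s z ∪ (openConn y z ∩ {ω | ∀ x ∈ X, ¬ (openGraph ω).Reachable y x})),
              F (openEdgeCluster ω s) ∂(prodBernoulli w)) -
          (∫ ω in {ω : BondConfig V | ∀ x ∈ X, ¬ (openGraph ω).Reachable s x},
              F (openEdgeCluster ω s) ∂(prodBernoulli w)) *
            (prodBernoulli w).real ({ω : BondConfig V | ∀ x ∈ X, ¬ (openGraph ω).Reachable s x} ∩
              (openConn s z ∪ (openConn y z ∩ {ω | ∀ x ∈ X, ¬ (openGraph ω).Reachable y x})))) +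
      (prodBernoulli w).real ({ω : BondConfig V | ∀ x ∈ insert s X, ¬ (openGraph ω).Reachable y x} ∩
          {ω | ∀ x ∈ X, ¬ (openGraph ω).Reachable s x} ∩ openConn y z) *
        ((prodBernoulli w).real {ω : BondConfig V | ∀ x ∈ X, ¬ (openGraph ω).Reachable s x} *
            (∫ ω in {ω : BondConfig V | ∀ x ∈ X, ¬ (openGraph ω).Reachable s x} ∩
                {ω | ∃ x ∈ X, (openGraph ω).Reachable y x},
              F (openEdgeCluster ω s) ∂(prodBernoulli w)) -
          (∫ ω in {ω : BondConfig V | ∀ x ∈ X, ¬ (openGraph ω).Reachable s x},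
              F (openEdgeCluster ω s) ∂(prodBernoulli w)) *
            (prodBernoulli w).real ({ω : BondConfig V | ∀ x ∈ X, ¬ (openGraph ω).Reachable s x} ∩
              {ω | ∃ x ∈ X, (openGraph ω).Reachable y x})) := by
  rw [setIntegral_avoid_eq_condS w s X F, setIntegral_avoid_swallow_eq_condS w s y X F]
  have hineq := setIntegral_avoid_observer_ge_condS w s y z X hF
  have h0 : ∀ S : Set (BondConfig V), 0 ≤ (prodBernoulli w).real S := fun _ => measureReal_nonneg
  nlinarith [hineq, mul_le_mul_of_nonneg_left hineq
    (mul_nonneg (h0 ({ω : BondConfig V | ∀ x ∈ insert s X, ¬ (openGraph ω).Reachable y x} ∩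
      {ω | ∀ x ∈ X, ¬ (openGraph ω).Reachable s x})) (h0 {ω : BondConfig V | ∀ x ∈ X, ¬ (openGraph ω).Reachable s x}))]

end Consts

end Summit.CriticalPhenomena.PercolationContinuityZ3.Theorems

end
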